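import Mathlib
import Summits.NavierStokesRegularity.NavierStokesRegularity.Theorems.SubOnsagerCeilingSideBranchDynamics
import HarnessLib

/-!
# Route SubOnsagerCeiling — the SECOND-MOMENT CAPTURE LAW of `α_SB`: a pocket plus its side mode never hold
# more than `((Λ_k/5)∫₀ᵗ x_k²)²` (true dynamics, no sign condition, no ceiling, any `ν ≥ 0`)
# (helper file for item stmt-NavierStokesRegularity-25507 `OrthantTailCeiling`; `--supports`; def-free)

Companion of `…SideBranchCaptureLaw.lean` (p826926, the fourth-moment law `Y√Y ≤ 4e^{ν_{k+1}t}(Λ_k/5)∫₀ᵗx_k⁴`,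
`Y = s_k² + z_{k+1}²`).  The same energy identity of the pair (side mode `s_k`, pocket `z_{k+1}`),
`d/dt(s_k² + z_{k+1}²) = 2(Λ_k/5)x_k²s_k − 2ν_k s_k² − 2ν_{k+1}z_{k+1}² ≤ 2(Λ_k/5)x_k²·√(s_k²+z_{k+1}²)`, integrated
through `√(Y + δ²)` (which is differentiable) and `δ ↓ 0`, gives the

* **second-moment capture law** `sideBranch_capture_second_moment`: with empty side mode and pocket at time `0`,
  `s_k(t)² + z_{k+1}(t)² ≤ ((Λ_k/5)∫₀ᵗ x_k²)²` for all `t ∈ [0,s]` — no viscous factor, no sign condition.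

Use (memo OCCUPATION-LEAK-leafhand4-g12.md on the items, §4): the two laws are complementary — the fourth-moment law
decays along the shells (`(Λ_k∫x_k⁴)^{2/3} ≍ b^{−5k/9}` on the Kolmogorov wake) but is lossy on the LOW shells, where the
second-moment law (`Λ_k∫x_k² = O(1)`) is sharp and quadratic in the pump; on the true trajectory of `α_SB` (b = 2, t = 3.75)
the parking budget `Σ_{j<8}` drops from `1.50·E₀` (fourth-moment law alone — above `E₀`, so the occupation-bound hypothesis
of `…SideBranchOccupationHorizon.lean` is out of reach as typed) to `0.67·E₀` with the minimum of the two laws, and to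
`0.23·E₀` for the pump re-parametrised to `1/20`.  NOT proved here: any bound on the chain occupations themselves.
HONEST FRAMING: elementary real analysis of a Tao-type MODEL lattice ODE (route SubOnsagerCeiling, rung TL-M2Break); a
brick toward a construction that is NOT carried out here; nothing bears on Navier–Stokes regularity; no crux is settled
here. [cite: Tao2016AveragedNS, §4 (4.2)–(4.3)]; Katz–Pavlović couplings: [cite: BarbatoMorandinRomito2011, §2].
-/

noncomputable section

-- the sub-problem namespace `NavierStokesRegularity.NavierStokesRegularity` is the tree's layout (D-0017)
set_option linter.dupNamespace false

namespace Summit.NavierStokesRegularity.NavierStokesRegularity.Theorems.SubOnsagerCeiling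

open Set MeasureTheory intervalIntegral
open Literature.Analysis.FluidPDE.TaoCascade

section Solution

variable {ε₀ ν s : ℝ} {X : Fin 4 → ℤ → ℝ → ℝ}

/-- `a ≥ 0` and `a ≤ b² + 2δb` for every `δ > 0` (`b ≥ 0`) give `a ≤ b²`. [folklore] -/
theorem sideBranch_le_sq_of_forall_pos {a b : ℝ} (hb : 0 ≤ b)
    (h : ∀ δ : ℝ, 0 < δ → a ≤ b ^ 2 + 2 * δ * b) : a ≤ b ^ 2 := by
  refine le_of_forall_pos_le_add fun η hη => ?_
  have hδ : 0 < η / (2 * b + 1) := div_pos hη (by linarith)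
  have h1 := h _ hδ
  have h2 : 2 * (η / (2 * b + 1)) * b ≤ η := by
    rw [show 2 * (η / (2 * b + 1)) * b = η * (2 * b / (2 * b + 1)) by ring]
    have : 2 * b / (2 * b + 1) ≤ 1 := by
      rw [div_le_one (by linarith)]; linarith
    calc η * (2 * b / (2 * b + 1)) ≤ η * 1 := mul_le_mul_of_nonneg_left this hη.le
      _ = η := mul_one η
  linarith

/-- **The `δ`-regularised law.** Along a regular solution of the `ν`-viscous `α_SB` lattice on `[0,s]` (`ν ≥ 0`,
continuous modes; NO sign condition), for every shell `k` with `s_k(0) = z_{k+1}(0) = 0`, every `δ > 0` and every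
`t ∈ [0,s]`: `√(s_k(t)² + z_{k+1}(t)² + δ²) ≤ δ + (Λ_k/5)∫₀ᵗ x_k²`
(`Φ = √(Y+δ²) − (Λ_k/5)∫x_k²` has `Φ' = (Y'/2)/√(Y+δ²) − (Λ_k/5)x_k² ≤ 0` because `Y' ≤ 2(Λ_k/5)x_k²|s_k|` and
`|s_k| ≤ √(Y+δ²)`). [this file] -/
theorem sideBranch_capture_sqrt_delta (hε : 0 < ε₀) (hν : 0 ≤ ν)
    (hcont : ∀ (i : Fin 4) (k : ℤ), Continuous (X i k))
    (hder : ∀ (i : Fin 4) (k : ℤ), ∀ t ∈ Icc (0 : ℝ) s, HasDerivWithinAt (X i k)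
      (quadTerm ε₀ sideBranchTable X i k t - ν * (1 + ε₀) ^ ((2 : ℝ) * k) * X i k t)
      (Icc (0 : ℝ) s) t)
    (k : ℤ) (hs0 : X 1 k 0 = 0) (hz0 : X 2 (k + 1) 0 = 0) {δ : ℝ} (hδ : 0 < δ)
    {t : ℝ} (ht : t ∈ Icc (0 : ℝ) s) :
    Real.sqrt (X 1 k t ^ 2 + X 2 (k + 1) t ^ 2 + δ ^ 2) ≤
      δ + (1 / 5 : ℝ) * (1 + ε₀) ^ ((5 : ℝ) * k / 2) * ∫ u in (0 : ℝ)..t, X 0 k u ^ 2 := by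
  have hb : (0 : ℝ) < 1 + ε₀ := by linarith
  set L : ℝ := (1 / 5 : ℝ) * (1 + ε₀) ^ ((5 : ℝ) * k / 2) with hL
  set c₀ : ℝ := ν * (1 + ε₀) ^ ((2 : ℝ) * k) with hc₀
  set c₁ : ℝ := ν * (1 + ε₀) ^ ((2 : ℝ) * ((k + 1 : ℤ) : ℝ)) with hc₁
  have hL0 : 0 ≤ L := mul_nonneg (by norm_num) (Real.rpow_nonneg hb.le _)
  have hc₀0 : 0 ≤ c₀ := mul_nonneg hν (Real.rpow_nonneg hb.le _)
  have hc₁0 : 0 ≤ c₁ := mul_nonneg hν (Real.rpow_nonneg hb.le _)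
  -- the two equations in closed form
  have hsd : ∀ u ∈ Icc (0 : ℝ) s, HasDerivWithinAt (X 1 k)
      (L * X 0 k u ^ 2 - L * (X 1 k u * X 2 (k + 1) u) - c₀ * X 1 k u) (Icc 0 s) u := by
    intro u hu
    have h := hder 1 k u hu
    rw [sideBranch_quadTerm_one] at h
    exact h
  have hzd : ∀ u ∈ Icc (0 : ℝ) s, HasDerivWithinAt (X 2 (k + 1))
      (L * X 1 k u ^ 2 - c₁ * X 2 (k + 1) u) (Icc 0 s) u := by
    intro u hu
    have h := hder 2 (k + 1) u hu
    rw [sideBranch_quadTerm_two_succ] at h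
    exact h
  have h2 : Continuous fun u => X 0 k u ^ 2 := (hcont 0 k).pow 2
  -- the regularised pair energy `Y + δ²` and its derivative
  set Yδ : ℝ → ℝ := fun u => X 1 k u ^ 2 + X 2 (k + 1) u ^ 2 + δ ^ 2 with hYδ
  set D : ℝ → ℝ := fun u => 2 * X 1 k u * (L * X 0 k u ^ 2 - L * (X 1 k u * X 2 (k + 1) u) - c₀ * X 1 k u) +
    2 * X 2 (k + 1) u * (L * X 1 k u ^ 2 - c₁ * X 2 (k + 1) u) with hD
  have hYpos : ∀ u, 0 < Yδ u := fun u => by rw [hYδ]; positivity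
  have hYd : ∀ u ∈ Icc (0 : ℝ) s, HasDerivWithinAt Yδ (D u) (Icc 0 s) u := by
    intro u hu
    have h := ((hsd u hu).pow 2).add ((hzd u hu).pow 2)
    have h' := h.add_const (δ ^ 2)
    refine h'.congr_deriv ?_
    simp only [hD, Nat.cast_ofNat]
    ring
  -- the comparison function `Φ = √(Y+δ²) − L ∫ x_k²`
  set Φ : ℝ → ℝ := fun u => Real.sqrt (Yδ u) - L * ∫ x in (0 : ℝ)..u, X 0 k x ^ 2 with hΦ
  have hderΦ : ∀ u ∈ Icc (0 : ℝ) s, HasDerivWithinAt Φ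
      (D u / (2 * Real.sqrt (Yδ u)) - L * X 0 k u ^ 2) (Icc 0 s) u := by
    intro u hu
    have hA := ((h2.integral_hasStrictDerivAt 0 u).hasDerivAt).hasDerivWithinAt (s := Icc (0 : ℝ) s)
    have hS := (hYd u hu).sqrt (hYpos u).ne'
    exact hS.sub (hA.const_mul L)
  have hle : ∀ u ∈ Icc (0 : ℝ) s, D u / (2 * Real.sqrt (Yδ u)) - L * X 0 k u ^ 2 ≤ 0 := by
    intro u hu
    set R : ℝ := Real.sqrt (Yδ u) with hR
    have hRpos : 0 < R := Real.sqrt_pos.2 (hYpos u)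
    have hRsq : R ^ 2 = Yδ u := Real.sq_sqrt (hYpos u).le
    -- `|s_k| ≤ R`
    have hsR : X 1 k u ≤ R ∧ -R ≤ X 1 k u := by
      have hs2 : X 1 k u ^ 2 ≤ R ^ 2 := by
        rw [hRsq, hYδ]; nlinarith [sq_nonneg (X 2 (k + 1) u), sq_nonneg δ]
      constructor
      · nlinarith [sq_nonneg (X 1 k u - R), sq_nonneg (X 1 k u + R)]
      · nlinarith [sq_nonneg (X 1 k u - R), sq_nonneg (X 1 k u + R)]
    -- `D ≤ 2 L x_k² |s_k| ≤ 2 L x_k² R`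
    have hx2 : 0 ≤ L * X 0 k u ^ 2 := by positivity
    have hDle : D u ≤ 2 * R * (L * X 0 k u ^ 2) := by
      have hid : D u = 2 * (L * X 0 k u ^ 2) * X 1 k u - 2 * (c₀ * X 1 k u ^ 2) - 2 * (c₁ * X 2 (k + 1) u ^ 2) := by
        rw [hD]; ring
      rw [hid]
      have h1 : 0 ≤ c₀ * X 1 k u ^ 2 := by positivity
      have h3 : 0 ≤ c₁ * X 2 (k + 1) u ^ 2 := by positivity
      nlinarith [mul_le_mul_of_nonneg_left hsR.1 hx2]
    rw [sub_nonpos, div_le_iff₀ (by positivity)]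
    linarith
  have h := sideBranch_le_init_of_deriv_nonpos hderΦ hle ht
  have hΦ0 : Φ 0 = δ := by
    simp only [hΦ, hYδ, integral_same, mul_zero, sub_zero, hs0, hz0]
    rw [show (0 : ℝ) ^ 2 + 0 ^ 2 + δ ^ 2 = δ ^ 2 by ring, Real.sqrt_sq hδ.le]
  rw [hΦ0] at h
  have : Real.sqrt (Yδ t) - L * ∫ x in (0 : ℝ)..t, X 0 k x ^ 2 ≤ δ := h
  linarith

/-- **THE SECOND-MOMENT CAPTURE LAW of `α_SB`.** Along a regular solution of the `ν`-viscous `α_SB` lattice on `[0,s]`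
(`ν ≥ 0`, continuous modes; NO sign condition, NO ceiling), for every shell `k` with `s_k(0) = z_{k+1}(0) = 0` and
every `t ∈ [0,s]`: **`s_k(t)² + z_{k+1}(t)² ≤ ((Λ_k/5)∫₀ᵗ x_k²)²`** — the energy captured from the chain at shell `k`
(parked in `z_{k+1}` or still in `s_k`) is at most `½((Λ_k/5)∫₀ᵗ x_k(u)² du)²`, the square of the (pump-weighted)
SECOND-MOMENT OCCUPATION of the chain mode.  Sharp on the low shells; complementary to the fourth-moment law
`sideBranch_capture_law`. [this file] -/
theorem sideBranch_capture_second_moment (hε : 0 < ε₀) (hν : 0 ≤ ν)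
    (hcont : ∀ (i : Fin 4) (k : ℤ), Continuous (X i k))
    (hder : ∀ (i : Fin 4) (k : ℤ), ∀ t ∈ Icc (0 : ℝ) s, HasDerivWithinAt (X i k)
      (quadTerm ε₀ sideBranchTable X i k t - ν * (1 + ε₀) ^ ((2 : ℝ) * k) * X i k t)
      (Icc (0 : ℝ) s) t)
    (k : ℤ) (hs0 : X 1 k 0 = 0) (hz0 : X 2 (k + 1) 0 = 0) {t : ℝ} (ht : t ∈ Icc (0 : ℝ) s) :
    X 1 k t ^ 2 + X 2 (k + 1) t ^ 2 ≤
      ((1 / 5 : ℝ) * (1 + ε₀) ^ ((5 : ℝ) * k / 2) * ∫ u in (0 : ℝ)..t, X 0 k u ^ 2) ^ 2 := by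
  have hb : (0 : ℝ) < 1 + ε₀ := by linarith
  set F : ℝ := (1 / 5 : ℝ) * (1 + ε₀) ^ ((5 : ℝ) * k / 2) * ∫ u in (0 : ℝ)..t, X 0 k u ^ 2 with hF
  have hF0 : 0 ≤ F := by
    have hint : 0 ≤ ∫ u in (0 : ℝ)..t, X 0 k u ^ 2 :=
      intervalIntegral.integral_nonneg ht.1 fun u _ => by positivity
    exact mul_nonneg (mul_nonneg (by norm_num) (Real.rpow_nonneg hb.le _)) hint
  set Y : ℝ := X 1 k t ^ 2 + X 2 (k + 1) t ^ 2 with hY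
  have hY0 : 0 ≤ Y := by positivity
  refine sideBranch_le_sq_of_forall_pos hF0 fun δ hδ => ?_
  have h := sideBranch_capture_sqrt_delta hε hν hcont hder k hs0 hz0 hδ ht
  have hpos : 0 ≤ Y + δ ^ 2 := by positivity
  have hsq : Real.sqrt (Y + δ ^ 2) ^ 2 = Y + δ ^ 2 := Real.sq_sqrt hpos
  have hle : Real.sqrt (Y + δ ^ 2) ≤ δ + F := h
  have hge : 0 ≤ Real.sqrt (Y + δ ^ 2) := Real.sqrt_nonneg _
  nlinarith [mul_le_mul hle hle hge (by linarith)]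

end Solution

end Summit.NavierStokesRegularity.NavierStokesRegularity.Theorems.SubOnsagerCeiling

end
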